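import Summits.NavierStokesRegularity.FluidComputer.PalasekTowerHeredityWitnessUnconditional
import Summits.NavierStokesRegularity.FluidComputer.PalasekTowerHeredityAtOneWitness

/-!
# REGISTER v2.3′: the witness links of K2G, its first rung, its rungs and its base — all UNCONDITIONAL

Cell `ns-blowup`, seat `ns-blowup-ecbridge-6` (g2; D-0074 GROUP C «BRIDGE SUPPORT»; bears_on LADDER-NS
N1, route `PalasekTowerBreakdown`, items stmt-NavierStokesRegularity-19249 `HeredityAtOne`, 19250
`HeredityFromTwo`, 19178 `EpisodeInduction` = `EpisodeInductionG`, 19179 `EpisodeBase` = `RungG 1`).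
Companion of `PalasekTowerHeredityWitnessUnconditional.lean` (this seat: THE REDUCTION
`Stage.nonempty_extends_of_levelWitness'` with NO uniqueness hypothesis — the stage pins the design's
flow by forced Serrin–Masuda, a theorem of the tree) and of the `hU`-conditional files
`PalasekTowerHeredityWitnessRungs.lean` (p418125) / `PalasekTowerHeredityAtOneWitness.lean` (p419314),
every one of whose links is re-proved here WITHOUT `hU` (Tao's forced Cor. 11.4, W14 — the route's
support item `TaoForcedUniqueness`, idle in every witness link from now on). LABEL: E–C typing
(KERNEL bookkeeping; theorems only). WHAT THIS IS NOT: not Navier–Stokes evidence — no stage, flow or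
tower is constructed; `HeredityWitness k` is a HYPOTHESIS (MODEL tower words are ANALOGUES of it,
never instances); nothing here asserts it, nor regularity, nor blow-up.

* `heredityAt_iff_heredityWitness'` — heredity at level `k` ⇔ the witness at level `k`;
* **`heredityAtOne_iff_heredityWitness_one : HeredityAtOne ↔ HeredityWitness 1`** — the first-rung
  stub IS its typed numerical-witness hypothesis, by value, with no hypothesis;
  `heredityAtOne_of_heredityWitness'`;
* `heredityFrom_iff_heredityWitness'`, `episodeInductionG_iff_heredityWitness'` (K2G ⇔ the witness
  at every `k ≥ 1`), `episodeInductionG_iff_heredityWitness_one_and_from_two` (the planner's split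
  `HeredityAtOne ∧ HeredityFrom 2` in witness form);
* `rungG_succ_of_levelWitness'` (ONE design's certificate lifts its rung — the shape a single
  certificate instantiates), `rungG_two_of_levelWitness'`;
* the base: `episodeBaseG_of_levelWitness_zero'`, `episodeBaseG_iff_exists_levelWitness_zero`
  (`EpisodeBaseG ↔` some prepared host — a `RungG 0` design — carries its own level-`0` witness),
  `episodeBaseG_of_rungG_zero_of_heredityWitness'`, `heredityAt_zero_iff_heredityWitness_zero`.

References: H. Sohr, *The Navier–Stokes Equations*, Birkhäuser 2001, Ch. V Thm. 1.5.1 (Serrin,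
Masuda) [cite: Sohr2001, Ch. V Thm. 1.5.1]; S. Palasek, arXiv:2605.13827 §4
[cite: Palasek2026ElementaryModel, §4].
-/

noncomputable section

namespace Summit.NavierStokesRegularity.FluidComputer.PalasekTowerClayBridge

open Set MeasureTheory Filter Topology Function Real
open scoped ENNReal ContDiff NNReal
open Literature.Analysis.FluidPDE

/-- **The heredity witness at level `k` gives heredity at level `k` — unconditionally** (W14-free
twin of `HeredityWitness.heredityAt (hU)`). [cite: Sohr2001, Ch. V Thm. 1.5.1] -/
theorem HeredityWitness.heredityAt' {k : ℕ} (h : HeredityWitness k) : HeredityAt k :=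
  fun S hP hR hQ s => s.nonempty_extends_of_levelWitness' one_pos (h S hP hR hQ ⟨s⟩)

/-- **Heredity at level `k` ⇔ the heredity witness at level `k` — with NO hypothesis** (nothing
weaker or stronger is substituted: the two statements are equivalent outright).
[cite: Sohr2001, Ch. V Thm. 1.5.1] -/
theorem heredityAt_iff_heredityWitness' {k : ℕ} : HeredityAt k ↔ HeredityWitness k :=
  ⟨HeredityAt.heredityWitness, HeredityWitness.heredityAt'⟩

/-- **THE FIRST-RUNG STUB IS ITS TYPED WITNESS, UNCONDITIONALLY: `HeredityAtOne ↔ HeredityWitness 1`**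
(item stmt-NavierStokesRegularity-19249 by value; the route's support item `TaoForcedUniqueness` is
not needed). [cite: Sohr2001, Ch. V Thm. 1.5.1] -/
theorem heredityAtOne_iff_heredityWitness_one : HeredityAtOne ↔ HeredityWitness 1 :=
  heredityAtOne_iff.trans heredityAt_iff_heredityWitness'

/-- `heredity_at_one ⇐ HeredityWitness 1`, unconditionally (W14-free twin of
`heredityAtOne_of_heredityWitness (hU)` / `…_W14`). [cite: Sohr2001, Ch. V Thm. 1.5.1] -/
theorem heredityAtOne_of_heredityWitness' (h : HeredityWitness 1) : HeredityAtOne :=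
  heredityAtOne_iff_heredityWitness_one.2 h

/-- **Heredity from level `k₀` ⇔ the heredity witness at every level `k ≥ k₀` — unconditionally**;
at `k₀ = 2` this is the split child `HeredityFrom 2` (item stmt-…-19250) in witness form.
[cite: Sohr2001, Ch. V Thm. 1.5.1] -/
theorem heredityFrom_iff_heredityWitness' {k₀ : ℕ} :
    HeredityFrom k₀ ↔ ∀ k : ℕ, k₀ ≤ k → HeredityWitness k := by
  constructor
  · exact fun h k hk => (h.heredityAt hk).heredityWitness
  · intro h S hP hR hQ k hk s
    exact (h k hk).heredityAt' S hP hR hQ s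

/-- **K2G ⇔ the heredity witness at every level `k ≥ 1` — unconditionally** (W14-free twin of
`episodeInductionG_iff_heredityWitness (hU)`; item stmt-…-19178 by value).
[cite: Sohr2001, Ch. V Thm. 1.5.1] -/
theorem episodeInductionG_iff_heredityWitness' :
    EpisodeInductionG ↔ ∀ k : ℕ, 1 ≤ k → HeredityWitness k :=
  episodeInductionG_iff_heredityFrom_one.trans heredityFrom_iff_heredityWitness'

/-- **The planner's split in witness form, unconditionally**: K2G ⇔ (the witness at level `1`) ∧
(the witness at every level `k ≥ 2`). [cite: Sohr2001, Ch. V Thm. 1.5.1] -/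
theorem episodeInductionG_iff_heredityWitness_one_and_from_two :
    EpisodeInductionG ↔ HeredityWitness 1 ∧ ∀ k : ℕ, 2 ≤ k → HeredityWitness k := by
  rw [episodeInductionG_iff_heredityAtOne_and_heredityFrom_two, heredityAtOne_iff_heredityWitness_one,
    heredityFrom_iff_heredityWitness']

/-- **One design's level witness lifts its rung — unconditionally** (W14-free twin of
`rungG_succ_of_levelWitness (hU)`): a pinned rigid quiet design with a registered stage at level `k`
and a level witness at level `k` carries a registered stage at level `k + 1`. This is the shape a
single certificate instantiates. [cite: Sohr2001, Ch. V Thm. 1.5.1] -/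
theorem rungG_succ_of_levelWitness' {S : Schedule TowerRates.wide} (hP : S.Pins 8 (6 / 5))
    (hR : S.Rigid) (hQ : S.Quiet) {k : ℕ}
    (hs : Nonempty (Stage 1 TowerRates.wide S (Margins.routeG TowerRates.wide) k))
    (hW : S.LevelWitness 1 k) : RungG (k + 1) := by
  obtain ⟨s⟩ := hs
  obtain ⟨s', -⟩ := s.nonempty_extends_of_levelWitness' one_pos hW
  exact ⟨S, hP, hR, hQ, ⟨s'⟩⟩

/-- **The BC5 rung of record from K1G's own design, unconditionally**: a pinned rigid quiet design
with a registered level-`1` stage and a level witness at level `1` gives `RungG 2`.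
[cite: Sohr2001, Ch. V Thm. 1.5.1] -/
theorem rungG_two_of_levelWitness'
    (h : ∃ S : Schedule TowerRates.wide, S.Pins 8 (6 / 5) ∧ S.Rigid ∧ S.Quiet ∧
      Nonempty (Stage 1 TowerRates.wide S (Margins.routeG TowerRates.wide) 1) ∧ S.LevelWitness 1 1) :
    RungG 2 := by
  obtain ⟨S, hP, hR, hQ, hs, hW⟩ := h
  exact rungG_succ_of_levelWitness' hP hR hQ hs hW

/-- **THE BASE from a prepared host and its level-`0` witness — unconditionally** (W14-free twin of
`episodeBaseG_of_levelWitness_zero (hU)`): `EpisodeBaseG` (item stmt-…-19179, `= RungG 1`) follows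
from ONE pinned rigid quiet design with a registered level-`0` stage whose own flow is a level
witness at level `0`. [cite: Sohr2001, Ch. V Thm. 1.5.1] -/
theorem episodeBaseG_of_levelWitness_zero'
    (h : ∃ S : Schedule TowerRates.wide, S.Pins 8 (6 / 5) ∧ S.Rigid ∧ S.Quiet ∧
      Nonempty (Stage 1 TowerRates.wide S (Margins.routeG TowerRates.wide) 0) ∧ S.LevelWitness 1 0) :
    EpisodeBaseG := by
  obtain ⟨S, hP, hR, hQ, hs, hW⟩ := h
  exact rungG_one_iff.1 (rungG_succ_of_levelWitness' hP hR hQ hs hW)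

/-- **The base is EQUIVALENT to «some prepared host carries its own level-`0` witness»** (no
hypothesis): `EpisodeBaseG ↔ ∃` pinned rigid quiet design with a registered level-`0` stage
(`RungG 0`-shape, the base skeleton's `HostPreparation`) and a level witness at level `0`. The
forward direction restricts the level-`1` stage to level `0` (`Stage.restrictOfAntitone`, the
register margin is level-antitone) and reads the stage itself as the witness (`Stage.levelWitness`).
[cite: Sohr2001, Ch. V Thm. 1.5.1] -/
theorem episodeBaseG_iff_exists_levelWitness_zero :
    EpisodeBaseG ↔ ∃ S : Schedule TowerRates.wide, S.Pins 8 (6 / 5) ∧ S.Rigid ∧ S.Quiet ∧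
      Nonempty (Stage 1 TowerRates.wide S (Margins.routeG TowerRates.wide) 0) ∧
        S.LevelWitness 1 0 := by
  constructor
  · intro h
    obtain ⟨S, hP, hR, hQ, ⟨s₁⟩⟩ := rungG_one_iff.2 h
    exact ⟨S, hP, hR, hQ,
      ⟨s₁.restrictOfAntitone (Margins.antitone_routeG TowerRates.wide) (Nat.zero_le 1)⟩,
      s₁.levelWitness⟩
  · exact episodeBaseG_of_levelWitness_zero'

/-- **The base from host preparation (`RungG 0`) and the heredity witness at level `0` —
unconditionally** (W14-free twin of `episodeBaseG_of_rungG_zero_of_heredityWitness (hU)`; the base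
skeleton's composition with its universal stub `FirstEpisode = HeredityAt 0` in witness form).
[cite: Sohr2001, Ch. V Thm. 1.5.1] -/
theorem episodeBaseG_of_rungG_zero_of_heredityWitness' (h₀ : RungG 0) (h : HeredityWitness 0) :
    EpisodeBaseG := by
  obtain ⟨S, hP, hR, hQ, hs⟩ := h₀
  exact episodeBaseG_of_levelWitness_zero' ⟨S, hP, hR, hQ, hs, h S hP hR hQ hs⟩

/-- `HeredityAt 0` (the base skeleton's universal stub `FirstEpisode`) ⇔ `HeredityWitness 0`,
unconditionally. [cite: Sohr2001, Ch. V Thm. 1.5.1] -/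
theorem heredityAt_zero_iff_heredityWitness_zero : HeredityAt 0 ↔ HeredityWitness 0 :=
  heredityAt_iff_heredityWitness'

/-! ## Heredity is a statement about LEVELS REACHED, not about stages (appended by ecbridge-6 g2) -/

namespace Stage

variable {ν : ℝ} {R : TowerRates} {S : Schedule R} {k : ℕ}

/-- **Any registered stage one level up extends any registered stage — no hypothesis** (routeG
margins, any rates, any viscosity `ν > 0`): given stages `s` at level `k` and `s₁` at level `k + 1`
of the same schedule, `s₁.u = s.u` on `[0, τ k]` (`velocity_extends'`, W14-free), and
`exists_extends_of_velocity_continuation` re-gauges `s₁`'s pressure so that `s` itself extends.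
So the `∀ s, ∃ s', s.Extends s'` bookkeeping of K2G carries no information beyond WHICH LEVELS a
design reaches. [cite: Sohr2001, Ch. V Thm. 1.5.1] -/
theorem exists_extends_of_stage_succ (hν : 0 < ν) (s : Stage ν R S (Margins.routeG R) k)
    (s₁ : Stage ν R S (Margins.routeG R) (k + 1)) :
    ∃ s' : Stage ν R S (Margins.routeG R) (k + 1), s.Extends s' :=
  s.exists_extends_of_velocity_continuation s₁.classical (s.velocity_extends' hν s₁) s₁.energy
    (fun t ht x => s₁.ceiling (k + 1) le_rfl t ⟨(S.τ_pos k).le.trans ht.1, ht.2⟩ x)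
    (s₁.floor (k + 1) le_rfl) (s₁.routeG_strain (k + 1) le_rfl) (s₁.routeG_coreLedger (k + 1) le_rfl)

end Stage

/-- **`HeredityAt k` ⇔ «every pinned rigid quiet design that reaches level `k` reaches level
`k + 1`» — no hypothesis.** Reaching a level = `Nonempty (Stage 1 wide S routeG ·)`; the register's
`∀ s ∃ s', s.Extends s'` form is equivalent to plain level-by-level nonemptiness
(`Stage.exists_extends_of_stage_succ`). [cite: Sohr2001, Ch. V Thm. 1.5.1] -/
theorem heredityAt_iff_nonempty_succ {k : ℕ} :
    HeredityAt k ↔ ∀ S : Schedule TowerRates.wide, S.Pins 8 (6 / 5) → S.Rigid → S.Quiet →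
      Nonempty (Stage 1 TowerRates.wide S (Margins.routeG TowerRates.wide) k) →
        Nonempty (Stage 1 TowerRates.wide S (Margins.routeG TowerRates.wide) (k + 1)) := by
  constructor
  · rintro h S hP hR hQ ⟨s⟩
    obtain ⟨s', -⟩ := h S hP hR hQ s
    exact ⟨s'⟩
  · intro h S hP hR hQ s
    obtain ⟨s₁⟩ := h S hP hR hQ ⟨s⟩
    exact s.exists_extends_of_stage_succ one_pos s₁

/-- **The first rung ⇔ «every pinned rigid quiet design that reaches level `1` reaches level `2`»**
— no hypothesis. [cite: Sohr2001, Ch. V Thm. 1.5.1] -/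
theorem heredityAtOne_iff_nonempty_two :
    HeredityAtOne ↔ ∀ S : Schedule TowerRates.wide, S.Pins 8 (6 / 5) → S.Rigid → S.Quiet →
      Nonempty (Stage 1 TowerRates.wide S (Margins.routeG TowerRates.wide) 1) →
        Nonempty (Stage 1 TowerRates.wide S (Margins.routeG TowerRates.wide) 2) :=
  heredityAtOne_iff.trans heredityAt_iff_nonempty_succ

/-- **K2G ⇔ «every pinned rigid quiet design that reaches level `1` reaches EVERY level»** — no
hypothesis: the crux is a statement about the set of levels each registered design reaches
(upward induction from level `1`; downward by `Stage.restrictOfAntitone`, the register margin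
being level-antitone). [cite: Sohr2001, Ch. V Thm. 1.5.1] -/
theorem episodeInductionG_iff_reaches_all_levels :
    EpisodeInductionG ↔ ∀ S : Schedule TowerRates.wide, S.Pins 8 (6 / 5) → S.Rigid → S.Quiet →
      Nonempty (Stage 1 TowerRates.wide S (Margins.routeG TowerRates.wide) 1) →
        ∀ k : ℕ, 1 ≤ k → Nonempty (Stage 1 TowerRates.wide S (Margins.routeG TowerRates.wide) k) := by
  constructor
  · intro h S hP hR hQ h₁ k hk
    induction k, hk using Nat.le_induction with
    | base => exact h₁
    | succ k hk ih =>
      obtain ⟨s⟩ := ih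
      obtain ⟨s', -⟩ := h S hP hR hQ k hk s
      exact ⟨s'⟩
  · intro h S hP hR hQ k hk s
    have h₁ : Nonempty (Stage 1 TowerRates.wide S (Margins.routeG TowerRates.wide) 1) :=
      ⟨s.restrictOfAntitone (Margins.antitone_routeG TowerRates.wide) hk⟩
    obtain ⟨s₁⟩ := h S hP hR hQ h₁ (k + 1) (by omega)
    exact s.exists_extends_of_stage_succ one_pos s₁

/-- Hence K2G ⇔ level-by-level reachability `k → k + 1` for every `k ≥ 1` and every pinned rigid quiet
design — no hypothesis. [cite: Sohr2001, Ch. V Thm. 1.5.1] -/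
theorem episodeInductionG_iff_nonempty_succ :
    EpisodeInductionG ↔ ∀ S : Schedule TowerRates.wide, S.Pins 8 (6 / 5) → S.Rigid → S.Quiet →
      ∀ k : ℕ, 1 ≤ k → Nonempty (Stage 1 TowerRates.wide S (Margins.routeG TowerRates.wide) k) →
        Nonempty (Stage 1 TowerRates.wide S (Margins.routeG TowerRates.wide) (k + 1)) := by
  rw [episodeInductionG_iff_heredityFrom_one]
  constructor
  · intro h S hP hR hQ k hk hs
    exact heredityAt_iff_nonempty_succ.1 (h.heredityAt hk) S hP hR hQ hs
  · intro h S hP hR hQ k hk s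
    obtain ⟨s₁⟩ := h S hP hR hQ k hk ⟨s⟩
    exact s.exists_extends_of_stage_succ one_pos s₁

end Summit.NavierStokesRegularity.FluidComputer.PalasekTowerClayBridge

end
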